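import Literature.MathematicalPhysics.QuantumFieldTheory.Balaban1983to89.LatticeFieldCalculus

/-!
# `Balaban1983to89.B5Eq118OneStroke` — T. Bałaban, *Propagators and renormalization transformations for lattice gauge
theories. I*, Commun. Math. Phys. **95** (1984) 17–40 [Balaban1984PropagatorsI]: the ONE-STROKE FORMULA (1.18) p. 20 for the
`k`-fold linear bond average `Q_k` (and (1.20) for `Q'_k`), PROVED for the composite `LatticeFieldCalculus.bondAvgIter`

HONEST FRAMING (cell `lit-balaban`, verbatim): statement-level skeleton of published theorems with citation tags; proofs
where landed; nothing here is a claim about the Yang–Mills mass gap.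

PDF held: `paper:balaban1984-cmp95-propagators-rt-i` (journal page = PDF page + 16).  Displays read for this module as
images from the page renders `run/shared/lean/pub/pub-balaban/b2b-balaban-ref1/pages/1984-cmp95-propagators-rt-I/…-p003-x2.png`
(p. 19) and `…-p004-x2.png` (p. 20).

CITATION HEADER (lean-in-tree rule).  Phase-2 proof file of the lit-balaban typed skeleton (HOME
`run/shared/lean/pub/lit-balaban/`, PHASE2-TARGETS.md §G seat **p39**), SKELETON row `B5.Eq1.11-1.18` (r18 register A02;
decls of record `LatticeFieldCalculus.bondAvg` (1.11) and `LatticeFieldCalculus.bondAvgIter` (1.16)–(1.18), p239006, whose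
docstring records the one-stroke formula as the INTENDED unfolding of the `k`-fold composite; the unfolding is proved here).

WHAT IS PRINTED (verbatim).  p. 19: *"(QA)_c = Σ_{x∈B(c₋)} L^{−(d+1)} A([x, x(c)]), … (1.11)"*, with (1.8) *"where
`A(Γ) = Σ_{b⊂Γ} A_b` for arbitrary contour `Γ`, and `x(c)` denotes a point in the block `B(c₊)` obtained by translation of `x`
by the bond `c`, so if `c = ⟨y, y + Le_μ⟩` then `x(c) = x + Le_μ`"*.  p. 20: *"`Q₂` is defined as `Q` only with the number `L`
replaced by `L²` in all definitions. It is easily seen that a composition of `k` transformations is given by (1.17) where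
`(Q_kA)_b = Σ_{x∈B^k(b₋)} η^{d+1} A([x, x(b)])`, `b ⊂ T₁^{(k)} = ℤ^d ∩ T_η`, `η = L^{−k}`, (1.18)
and `x(b)` is a point in `B^k(b₊)` obtained from `x` by translation by `b`. If `b = ⟨y, y + e_μ⟩`, then `x(b) = x + e_μ`."*
and *"or denoting `(Q'_kλ)(y) = Σ_{x∈B^k(y)} η^d λ(x)`, we have `Q_kA^λ = Q_kA − ∂Q'_kλ`"* (1.20).

WHAT THIS MODULE PROVES, over the carriers of record (`Setup`: `Site P j`, `PBond P j`, `blockOf`, `block`; `TorusGeometry`: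
`Site.blockEquiv`, `Site.card_block`; `LatticeFieldCalculus`: `runSite`, `segSum`, `bondAvg`, `siteAvg`, `bondAvgIter`,
`siteAvgIter`), in the standing range `k ≤ m + K` of `Setup` (outside it the site counts `sitesPerDir` are truncated and the
block maps are not the printed ones):
* §1 the iterated blocks `B^k(y) ⊂ T^{(0)}` of a site `y ∈ T^{(k)}` as the fibres of the `k`-fold block map
  (`iterBlockOf`, `iterBlock`), with `B^{k+1}(y) = ⋃_{z∈B(y)} B^k(z)` (`iterBlock_succ`, `sum_iterBlock_succ`), the cube
  description of (1.6) in labels (`val_iterBlockOf`, `mem_iterBlock_iff`: `x ∈ B^k(y)` iff the labels of `x` integer-divided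
  by `L^k` are those of `y`) and `|B^k(y)| = L^{kd}` (`card_iterBlock`);
* §2 translation covariance: a translation by `t·L^k` steps of `T^{(0)}` is a translation by `t` steps of `T^{(k)}` under the
  `k`-fold block map (`blockOf_runSite_mul`, `iterBlockOf_runSite`), so `x(b) = x + L^k e_μ ∈ B^k(b₊)` for `x ∈ B^k(b₋)`
  (`runSite_mem_iterBlock_tgt`) and sums over `B^k(z + t e_μ)` are sums over `B^k(z)` of the translate (`sum_iterBlock_runSite`);
* §3 additivity of straight-contour sums, `A([x, x + (m+n)e]) = A([x, x + me]) + A([x + me, x + (m+n)e])` (`segSum_add`), hence a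
  run of `n·m` bonds is `n` consecutive runs of `m` bonds (`segSum_mul`);
* §4 the one-level averages (1.11)/(1.13) as sums over the `Finset` block `B(y)` (`bondAvg_eq_blockSum`; the site version is
  `LatticeFieldCalculus.siteAvg_eq_blockSum`);
* §5 THE ONE-STROKE FORMULAS: `bondAvgIter_eq_blockSum` / `eq118` —
  `(Q_kA)(b) = Σ_{x∈B^k(b₋)} η^{d+1} A([x, x + L^k e_{μ(b)}])`, `η^{d+1} = L^{−k(d+1)}`, i.e. the `k`-fold composite of the
  one-level average (1.11) IS the single average (1.18) over the block of order `k` of the straight contours of `L^k` bonds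
  (induction on `k`: §1 decomposition, §2 reindexing, §3 splitting of the long contour into `L` contours of `L^k` bonds = the
  contours averaged by the inner `Q_k` at the `L` sites of the outer straight contour); and `siteAvgIter_eq_blockSum` / `eq120`
  — `(Q'_kλ)(y) = Σ_{x∈B^k(y)} η^d λ(x)`.
WHY NEW BLOCK OBJECTS.  The tree has the `j`-fold block map twice on other index conventions: `B7SectAStatements.blockOfIter j :
Site P i → Site P (i + j)` (general base level; at `i = 0` its values live in `Site P (0 + k)`, which is not definitionally
`Site P k`, the index of `bondAvgIter k`) and `HiggsAveraging.blockIter` (on the `HiggsLattice` carrier of B1–B3, not `Setup`).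
`iterBlockOf k : Site P 0 → Site P k` below is the same recursion at base level `0` on the `Setup` carrier; nothing is restated
about those objects.  DIVERGENCE (inherited, flagged): `Setup`'s blocks are the CENTRED cubes of B12 (0.1)/(0.3) (`L` odd),
(1.6) anchors `B(y)` at its corner (cell `pub-balaban` F3, documented at `Setup.blockOf`); (1.18) is insensitive to the anchor.
Nothing else of the paper is asserted; no `Prop` fact is introduced; axioms standard.  Unit `lit-balaban-p39`
(literature-prover-lit-balaban-p39-0), 2026-08-21; HOME/FILED.md records the proposal.
-/

open scoped BigOperators

namespace Literature.MathematicalPhysics.QuantumFieldTheory.Balaban1983to89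

namespace B5Eq118OneStroke

open LatticeFieldCalculus

variable {P : Params}

/-! ## 1. The blocks of order `k`, `B^k(y) ⊂ T^{(0)}` ([Balaban1984PropagatorsI] (1.6), (1.18): "`x ∈ B^k(b₋)`") -/

section Blocks

/-- The `k`-FOLD BLOCK MAP `T^{(0)} → T^{(k)}`: `x ↦` the site `y` of the `k` times coarser lattice with `x ∈ B^k(y)`, the `k`-th
iterate of the one-level block map `blockOf` of `Setup` (B12 (0.3) centred cubes; (1.6) p. 18 *"divide the lattice `T₁` into
blocks"*, iterated in (1.16)–(1.18): `Q₂` "with the number `L` replaced by `L²`", `Q_k` over `B^k(b₋)`). [cite: Balaban1984PropagatorsI, (1.18) p.20] -/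
def iterBlockOf : (k : ℕ) → Site P 0 → Site P k
  | 0, x => x
  | k + 1, x => blockOf (iterBlockOf k x)

/-- `B⁰`: no coarsening. [cite: Balaban1984PropagatorsI, (1.18) p.20] -/
@[simp] theorem iterBlockOf_zero (x : Site P 0) : iterBlockOf 0 x = x := rfl

/-- One more level: the `(k+1)`-fold block point is the block point of the `k`-fold one. [cite: Balaban1984PropagatorsI, (1.18) p.20] -/
@[simp] theorem iterBlockOf_succ (k : ℕ) (x : Site P 0) : iterBlockOf (k + 1) x = blockOf (iterBlockOf k x) := rfl

/-- THE BLOCK OF ORDER `k`, `B^k(y) ⊂ T^{(0)}` (= `T_η`, `η = L^{-k}`), of a site `y ∈ T^{(k)}`: the `L^{kd}` sites of the finest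
lattice whose `k`-fold block point is `y` ((1.18): the summation range `x ∈ B^k(b₋)`), as a `Finset`. [cite: Balaban1984PropagatorsI, (1.18) p.20] -/
def iterBlock (k : ℕ) (y : Site P k) : Finset (Site P 0) :=
  Finset.univ.filter fun x => iterBlockOf k x = y

/-- `x ∈ B^k(y)` iff the `k`-fold block point of `x` is `y`. [cite: Balaban1984PropagatorsI, (1.18) p.20] -/
@[simp] theorem mem_iterBlock (k : ℕ) (y : Site P k) (x : Site P 0) : x ∈ iterBlock k y ↔ iterBlockOf k x = y := by
  simp [iterBlock]

/-- `B⁰(y) = {y}`. [cite: Balaban1984PropagatorsI, (1.18) p.20] -/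
theorem iterBlock_zero (y : Site P 0) : iterBlock 0 y = {y} := by
  ext x
  simp [eq_comm]

/-- NESTING OF BLOCKS: `B^{k+1}(y) = ⋃_{z ∈ B(y)} B^k(z)` — the block of order `k+1` over `y ∈ T^{(k+1)}` is the union of the
blocks of order `k` over the sites of the one-level block `B(y) ⊂ T^{(k)}` ((1.16): the composite average is an average of
averages). [cite: Balaban1984PropagatorsI, (1.16) p.20] -/
theorem iterBlock_succ (k : ℕ) (y : Site P (k + 1)) : iterBlock (k + 1) y = (block y).biUnion (iterBlock k) := by
  ext x
  simp [block]

/-- Distinct sites of `T^{(k)}` have disjoint blocks of order `k`. [cite: Balaban1984PropagatorsI, (1.18) p.20] -/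
theorem pairwiseDisjoint_iterBlock (k : ℕ) (s : Set (Site P k)) : s.PairwiseDisjoint (iterBlock k) := by
  intro y _ y' _ h
  refine Finset.disjoint_left.mpr fun x hx hx' => h ?_
  rw [mem_iterBlock] at hx hx'
  exact hx.symm.trans hx'

/-- `Σ_{x ∈ B^{k+1}(y)} = Σ_{z ∈ B(y)} Σ_{x ∈ B^k(z)}` (the nesting `iterBlock_succ` as a summation identity). [cite: Balaban1984PropagatorsI, (1.16) p.20] -/
theorem sum_iterBlock_succ {M : Type*} [AddCommMonoid M] (k : ℕ) (y : Site P (k + 1)) (f : Site P 0 → M) :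
    ∑ x ∈ iterBlock (k + 1) y, f x = ∑ z ∈ block y, ∑ x ∈ iterBlock k z, f x := by
  rw [iterBlock_succ, Finset.sum_biUnion (pairwiseDisjoint_iterBlock k _)]

/-- THE CUBE DESCRIPTION (1.6) in labels: the label of the `k`-fold block point is the label integer-divided by `L^k`
(coordinatewise; standing range `k ≤ m + K`; B12's centred labelling, DIVERGENCE F3). [cite: Balaban1984PropagatorsI, (1.6) p.18] -/
theorem val_iterBlockOf : ∀ (k : ℕ), k ≤ P.m + P.K → ∀ (x : Site P 0) (μ : Fin P.d),
    ((iterBlockOf k x) μ).val = (x μ).val / P.L ^ k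
  | 0, _, x, μ => by simp
  | k + 1, hk, x, μ => by
    rw [iterBlockOf_succ, Site.val_blockOf (by omega), val_iterBlockOf k (by omega) x μ, pow_succ, Nat.div_div_eq_div_mul]

/-- `x ∈ B^k(y)` iff, in every coordinate, (label of `x`) div `L^k` = label of `y`: `B^k(y)` is the cube of side `L^k` (in steps
of `T^{(0)}`) of the fine sites over `y` ((1.6) with `L^k` for `L`; standing range). [cite: Balaban1984PropagatorsI, (1.6) p.18] -/
theorem mem_iterBlock_iff {k : ℕ} (hk : k ≤ P.m + P.K) (y : Site P k) (x : Site P 0) :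
    x ∈ iterBlock k y ↔ ∀ μ : Fin P.d, (x μ).val / P.L ^ k = (y μ).val := by
  rw [mem_iterBlock]
  constructor
  · rintro rfl μ
    exact (val_iterBlockOf k hk x μ).symm
  · intro h
    funext μ
    apply ZMod.val_injective
    rw [val_iterBlockOf k hk]
    exact h μ

/-- `|B^k(y)| = L^{kd}` (standing range): the block of order `k` consists of `(L^d)^k` sites of the finest lattice
("`T^{(k)}_1 = ℤ^d ∩ T_η`", `η = L^{-k}`: `L^{kd}` points of `T_η` per unit cube). [cite: Balaban1984PropagatorsI, (1.18) p.20] -/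
theorem card_iterBlock : ∀ (k : ℕ), k ≤ P.m + P.K → ∀ (y : Site P k), (iterBlock k y).card = (P.L ^ P.d) ^ k
  | 0, _, y => by simp [iterBlock_zero]
  | k + 1, hk, y => by
    rw [iterBlock_succ, Finset.card_biUnion (pairwiseDisjoint_iterBlock k _),
      Finset.sum_congr rfl fun z _ => card_iterBlock k (by omega) z, Finset.sum_const, Site.card_block hk, smul_eq_mul,
      pow_succ, mul_comm]

end Blocks

/-! ## 2. Translations: `x(b) = x + L^k e_μ ∈ B^k(b₊)` for `x ∈ B^k(b₋)` ([Balaban1984PropagatorsI] p. 20, after (1.18)) -/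

section Translations

/-- Translation by `a` steps in the direction `μ` as a permutation of the sites of `T^{(j)}`. [folklore] -/
private def transl {j : ℕ} (μ : Fin P.d) (a : ZMod (P.sitesPerDir j)) : Site P j ≃ Site P j where
  toFun x := Function.update x μ (x μ + a)
  invFun x := Function.update x μ (x μ - a)
  left_inv x := by
    funext ν
    by_cases h : ν = μ
    · subst h; simp
    · simp [Function.update_of_ne h]
  right_inv x := by
    funext ν
    by_cases h : ν = μ
    · subst h; simp
    · simp [Function.update_of_ne h]

/-- The label arithmetic behind `blockOf_runSite_mul`: `((a + tL) mod N_j) div L = (a div L + t) mod N_{j+1}`, `N_j = N_{j+1}·L`. [folklore] -/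
private theorem mod_div_label {j : ℕ} (hj : j + 1 ≤ P.m + P.K) (a t : ℕ) :
    (a + t * P.L) % P.sitesPerDir j / P.L = (a / P.L + t) % P.sitesPerDir (j + 1) := by
  rw [P.sitesPerDir_eq_mul_succ hj, Nat.mod_mul_left_div_self, Nat.add_mul_div_right _ _ P.L_pos]

/-- ONE LEVEL: translating a fine site by `t·L` steps translates its block point by `t` steps, `B(y) + tL e_μ = B(y + t e_μ)`
((1.8)/(1.11): "`x(c)` denotes a point in the block `B(c₊)` obtained by translation of `x` by the bond `c`, so if
`c = ⟨y, y + Le_μ⟩` then `x(c) = x + Le_μ`"; standing range). [cite: Balaban1984PropagatorsI, (1.8) p.19] -/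
theorem blockOf_runSite_mul {j : ℕ} (hj : j + 1 ≤ P.m + P.K) (x : Site P j) (μ : Fin P.d) (t : ℕ) :
    blockOf (runSite x μ (t * P.L)) = runSite (blockOf x) μ t := by
  funext ν
  by_cases hν : ν = μ
  · subst hν
    simp only [blockOf, runSite, Function.update_self]
    have h1 : x ν + ((t * P.L : ℕ) : ZMod (P.sitesPerDir j)) = (((x ν).val + t * P.L : ℕ) : ZMod (P.sitesPerDir j)) := by
      rw [Nat.cast_add, ZMod.natCast_zmod_val]
    rw [h1, ZMod.val_natCast, mod_div_label hj, ZMod.natCast_mod, Nat.cast_add]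
  · simp only [blockOf, runSite, Function.update_of_ne hν]

/-- `k` LEVELS: translating a site of `T^{(0)}` by `t·L^k` steps translates its `k`-fold block point by `t` steps of `T^{(k)}`,
`B^k(y) + tL^k e_μ = B^k(y + t e_μ)` (p. 20: "`x(b)` is a point in `B^k(b₊)` obtained from `x` by translation by `b`";
standing range). [cite: Balaban1984PropagatorsI, (1.18) p.20] -/
theorem iterBlockOf_runSite : ∀ (k : ℕ), k ≤ P.m + P.K → ∀ (x : Site P 0) (μ : Fin P.d) (t : ℕ),
    iterBlockOf k (runSite x μ (t * P.L ^ k)) = runSite (iterBlockOf k x) μ t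
  | 0, _, x, μ, t => by simp
  | k + 1, hk, x, μ, t => by
    have h : t * P.L ^ (k + 1) = (t * P.L) * P.L ^ k := by rw [pow_succ]; ring
    simp only [iterBlockOf_succ]
    rw [h, iterBlockOf_runSite k (by omega) x μ (t * P.L), blockOf_runSite_mul (by omega : k + 1 ≤ P.m + P.K)]

/-- `x + e_μ` on `T^{(k)}` is `runSite · μ 1`. [folklore] -/
private theorem runSite_one {j : ℕ} (z : Site P j) (μ : Fin P.d) : runSite z μ 1 = z.shift μ := by
  simp [runSite, Site.shift]

/-- "`x(b)` IS A POINT IN `B^k(b₊)`": for `x ∈ B^k(b₋)`, `b = ⟨y, y + e_μ⟩ ⊂ T₁^{(k)}`, the end `x(b) = x + L^k e_μ` (in steps of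
`T^{(0)} = T_η`; `= x + e_μ` in the unit `η L^k = 1`) of the straight contour `[x, x(b)]` lies in the block of order `k` over `b₊`
(standing range). [cite: Balaban1984PropagatorsI, (1.18) p.20] -/
theorem runSite_mem_iterBlock_tgt {k : ℕ} (hk : k ≤ P.m + P.K) {b : PBond P k} {x : Site P 0} (hx : x ∈ iterBlock k b.src) :
    runSite x b.dir (P.L ^ k) ∈ iterBlock k b.tgt := by
  rw [mem_iterBlock] at hx ⊢
  have h := iterBlockOf_runSite k hk x b.dir 1
  rw [one_mul] at h
  rw [h, hx, runSite_one]
  rfl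

/-- REINDEXING: a sum over `B^k(z + t e_μ)` is the sum over `B^k(z)` of the translate by `t·L^k` fine steps (the translation is a
bijection `B^k(z) → B^k(z + t e_μ)`; standing range). [cite: Balaban1984PropagatorsI, (1.18) p.20] -/
theorem sum_iterBlock_runSite {M : Type*} [AddCommMonoid M] {k : ℕ} (hk : k ≤ P.m + P.K) (g : Site P 0 → M) (z : Site P k)
    (μ : Fin P.d) (t : ℕ) :
    ∑ x ∈ iterBlock k (runSite z μ t), g x = ∑ x ∈ iterBlock k z, g (runSite x μ (t * P.L ^ k)) := by
  simp only [iterBlock, Finset.sum_filter]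
  have hre := Equiv.sum_comp (transl μ ((t * P.L ^ k : ℕ) : ZMod (P.sitesPerDir 0)))
    (fun x : Site P 0 => if iterBlockOf k x = runSite z μ t then g x else 0)
  rw [← hre]
  refine Finset.sum_congr rfl fun x _ => ?_
  have hx : (transl μ ((t * P.L ^ k : ℕ) : ZMod (P.sitesPerDir 0))) x = runSite x μ (t * P.L ^ k) := rfl
  have hinj : runSite (iterBlockOf k x) μ t = runSite z μ t ↔ iterBlockOf k x = z :=
    (transl μ ((t : ℕ) : ZMod (P.sitesPerDir k))).injective.eq_iff
  simp only [hx, iterBlockOf_runSite k hk x μ t, hinj]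

end Translations

/-! ## 3. Straight contours: additivity of `A([x, x + n e_μ])` ([Balaban1984PropagatorsI] (1.7)–(1.8)) -/

section Segments

variable {j : ℕ} {V : Type*} [AddCommGroup V] [Module ℝ V]

omit [Module ℝ V] in
/-- `(x + m e_μ) + n e_μ = x + (m + n) e_μ`. [cite: Balaban1984PropagatorsI, (1.7) p.18] -/
theorem runSite_add (x : Site P j) (μ : Fin P.d) (m n : ℕ) : runSite (runSite x μ m) μ n = runSite x μ (m + n) := by
  simp only [runSite, Function.update_idem, Function.update_self]
  push_cast
  rw [add_assoc]

omit [Module ℝ V] in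
/-- ADDITIVITY OF CONTOUR SUMS under concatenation of straight contours:
`A([x, x + (m+n)e_μ]) = A([x, x + me_μ]) + A([x + me_μ, x + (m+n)e_μ])` ("`A(Γ) = Σ_{b⊂Γ} A_b` for arbitrary contour `Γ`"). [cite: Balaban1984PropagatorsI, (1.8) p.19] -/
theorem segSum_add (A : VecField P j V) (x : Site P j) (μ : Fin P.d) (m n : ℕ) :
    segSum A x μ (m + n) = segSum A x μ m + segSum A (runSite x μ m) μ n := by
  unfold segSum
  rw [Finset.sum_range_add]
  congr 1
  refine Finset.sum_congr rfl fun t _ => ?_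
  simp only [runBond, runSite_add]

omit [Module ℝ V] in
/-- A straight contour of `n·m` bonds is the concatenation of the `n` consecutive straight contours of `m` bonds starting at
`x, x + me_μ, …, x + (n−1)me_μ` (used with `m = L^k`, `n = L`: the contour `[x, x + L^{k+1}e_μ]` averaged by `Q_{k+1}` splits into
the `L` contours averaged by `Q_k` at the sites of the coarse contour `[x_k, x_k + Le_μ] ⊂ T^{(k)}`). [cite: Balaban1984PropagatorsI, (1.8) p.19] -/
theorem segSum_mul (A : VecField P j V) (x : Site P j) (μ : Fin P.d) (m : ℕ) : ∀ n : ℕ,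
    segSum A x μ (n * m) = ∑ t ∈ Finset.range n, segSum A (runSite x μ (t * m)) μ m
  | 0 => by simp [segSum]
  | n + 1 => by
    rw [Nat.succ_mul, segSum_add, segSum_mul A x μ m n, Finset.sum_range_succ]

end Segments

/-! ## 4. The one-level bond average (1.11) as a sum over the block `B(c₋)` -/

section OneLevel

variable {j : ℕ} {V : Type*} [AddCommGroup V] [Module ℝ V]

/-- (1.11) OVER THE BLOCK AS A SET: `(QA)(c) = L^{-(d+1)} Σ_{x ∈ B(c₋)} A([x, x(c)])` with `B(y) = {x : blockOf x = y}` of `Setup`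
(the definition `LatticeFieldCalculus.bondAvg` runs over the offset parametrisation `Site.blockSite`; in the standing range the two
agree by `Site.blockEquiv`, as for `siteAvg_eq_blockSum`). [cite: Balaban1984PropagatorsI, (1.11) p.19] -/
theorem bondAvg_eq_blockSum (hj : j + 1 ≤ P.m + P.K) (A : VecField P j V) (c : PBond P (j + 1)) :
    bondAvg A c = (((P.L : ℝ) ^ (P.d + 1))⁻¹) • ∑ z ∈ block c.src, segSum A z c.dir P.L := by
  unfold bondAvg
  congr 1
  have hmem : ∀ x : Site P j, blockOf x = c.src ↔ x ∈ block c.src := fun x => by simp [block]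
  let e : (Fin P.d → Fin P.L) ≃ ↥(block c.src) := (Site.blockEquiv hj c.src).symm.trans (Equiv.subtypeEquivRight hmem)
  rw [← Finset.sum_coe_sort (block c.src) (fun z => segSum A z c.dir P.L),
    ← Equiv.sum_comp e (fun a => segSum A a.1 c.dir P.L)]
  exact Finset.sum_congr rfl fun r _ => rfl

end OneLevel

/-! ## 5. The one-stroke formulas (1.18) for `Q_k` and (1.20) for `Q'_k` -/

section OneStroke

variable {V : Type*} [AddCommGroup V] [Module ℝ V]

/-- **(1.18)** p. 20 [PDF 4], THE ONE-STROKE FORMULA FOR `Q_k`, verbatim: *"It is easily seen that a composition of `k`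
transformations is given by (1.17) where `(Q_kA)_b = Σ_{x∈B^k(b₋)} η^{d+1} A([x, x(b)])`, `b ⊂ T₁^{(k)} = ℤ^d ∩ T_η`, `η = L^{−k}`, (1.18)
and `x(b)` is a point in `B^k(b₊)` obtained from `x` by translation by `b`. If `b = ⟨y, y + e_μ⟩`, then `x(b) = x + e_μ`."* — typed
reading: the `k`-fold composite `bondAvgIter k = Q ∘ ⋯ ∘ Q` of the one-level average (1.11) equals, at every bond `b` of `T^{(k)}`,
`L^{-k(d+1)}` times the sum over the block of order `k` over `b₋` of the sums of `A` along the straight contours of `L^k` bonds of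
`T^{(0)}` in the direction of `b` (from `x` to `x(b) = x + L^k e_μ ∈ B^k(b₊)`, `runSite_mem_iterBlock_tgt`); standing range `k ≤ m + K`.
Proof by induction on `k` ("easily seen"): `Q_{k+1}A = Q(Q_kA)` averages `Q_kA` over the `L` bonds of the coarse straight contours
from the sites of `B(b₋) ⊂ T^{(k)}`; by the induction hypothesis, the reindexing `sum_iterBlock_runSite` and the splitting
`segSum_mul` these are exactly the contributions of the `L` pieces of length `L^k` of the contours of length `L^{k+1}` from the sites of
`B^{k+1}(b₋) = ⋃_{z∈B(b₋)} B^k(z)`. [cite: Balaban1984PropagatorsI, (1.18) p.20] -/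
theorem bondAvgIter_eq_blockSum : ∀ (k : ℕ), k ≤ P.m + P.K → ∀ (A : VecField P 0 V) (b : PBond P k),
    bondAvgIter k A b = ((((P.L : ℝ) ^ (P.d + 1)) ^ k)⁻¹) • ∑ x ∈ iterBlock k b.src, segSum A x b.dir (P.L ^ k)
  | 0, _, A, ⟨y, μ⟩ => by
    simp [bondAvgIter, iterBlock_zero, segSum, runBond]
  | k + 1, hk, A, c => by
    have hk' : k ≤ P.m + P.K := by omega
    have ih : ∀ (z : Site P k) (t : ℕ), bondAvgIter k A ⟨runSite z c.dir t, c.dir⟩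
        = ((((P.L : ℝ) ^ (P.d + 1)) ^ k)⁻¹) •
            ∑ x ∈ iterBlock k z, segSum A (runSite x c.dir (t * P.L ^ k)) c.dir (P.L ^ k) := fun z t => by
      rw [bondAvgIter_eq_blockSum k hk' A ⟨runSite z c.dir t, c.dir⟩, sum_iterBlock_runSite hk']
    calc bondAvgIter (k + 1) A c
        = bondAvg (bondAvgIter k A) c := rfl
      _ = (((P.L : ℝ) ^ (P.d + 1))⁻¹) • ∑ z ∈ block c.src, ∑ t ∈ Finset.range P.L,
            bondAvgIter k A ⟨runSite z c.dir t, c.dir⟩ := by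
          rw [bondAvg_eq_blockSum hk]; rfl
      _ = (((P.L : ℝ) ^ (P.d + 1))⁻¹) • ∑ z ∈ block c.src, ∑ t ∈ Finset.range P.L,
            ((((P.L : ℝ) ^ (P.d + 1)) ^ k)⁻¹) •
              ∑ x ∈ iterBlock k z, segSum A (runSite x c.dir (t * P.L ^ k)) c.dir (P.L ^ k) := by
          simp only [ih]
      _ = ((((P.L : ℝ) ^ (P.d + 1)) ^ (k + 1))⁻¹) • ∑ z ∈ block c.src, ∑ t ∈ Finset.range P.L,
            ∑ x ∈ iterBlock k z, segSum A (runSite x c.dir (t * P.L ^ k)) c.dir (P.L ^ k) := by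
          simp only [← Finset.smul_sum, smul_smul]
          congr 1
          rw [← mul_inv, ← pow_succ']
      _ = ((((P.L : ℝ) ^ (P.d + 1)) ^ (k + 1))⁻¹) • ∑ z ∈ block c.src, ∑ x ∈ iterBlock k z,
            ∑ t ∈ Finset.range P.L, segSum A (runSite x c.dir (t * P.L ^ k)) c.dir (P.L ^ k) := by
          congr 1
          exact Finset.sum_congr rfl fun z _ => Finset.sum_comm
      _ = ((((P.L : ℝ) ^ (P.d + 1)) ^ (k + 1))⁻¹) • ∑ z ∈ block c.src, ∑ x ∈ iterBlock k z,
            segSum A x c.dir (P.L ^ (k + 1)) := by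
          congr 1
          refine Finset.sum_congr rfl fun z _ => Finset.sum_congr rfl fun x _ => ?_
          rw [pow_succ', segSum_mul]
      _ = ((((P.L : ℝ) ^ (P.d + 1)) ^ (k + 1))⁻¹) • ∑ x ∈ iterBlock (k + 1) c.src, segSum A x c.dir (P.L ^ (k + 1)) := by
          rw [sum_iterBlock_succ]

/-- `η^{d+1} = L^{-k(d+1)}` for `η = L^{-k}` (`Params.eta`). [folklore] -/
private theorem inv_pow_pow_eq_eta_pow (k n : ℕ) : ((((P.L : ℝ) ^ n) ^ k)⁻¹) = P.eta k ^ n := by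
  unfold Params.eta
  rw [← pow_mul, ← pow_mul, inv_pow, mul_comm]

/-- **(1.18)** AS PRINTED, with the weight `η^{d+1}`, `η = L^{-k}` (`Params.eta k`), inside the sum:
`(Q_kA)_b = Σ_{x∈B^k(b₋)} η^{d+1} A([x, x(b)])` (standing range). [cite: Balaban1984PropagatorsI, (1.18) p.20] -/
theorem eq118 {k : ℕ} (hk : k ≤ P.m + P.K) (A : VecField P 0 V) (b : PBond P k) :
    bondAvgIter k A b = ∑ x ∈ iterBlock k b.src, (P.eta k) ^ (P.d + 1) • segSum A x b.dir (P.L ^ k) := by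
  rw [bondAvgIter_eq_blockSum k hk A b, Finset.smul_sum, inv_pow_pow_eq_eta_pow]

/-- **(1.20)** p. 20 [PDF 4], THE ONE-STROKE FORMULA FOR `Q'_k`, verbatim: *"or denoting `(Q'_kλ)(y) = Σ_{x∈B^k(y)} η^d λ(x)`, we have
`Q_kA^λ = Q_kA − ∂Q'_kλ`"* — typed reading (the defining display only; the identity `Q_kA^λ = Q_kA − ∂Q'_kλ` is the one-level
`LatticeFieldCalculus.bondAvg_gaugeShift` iterated, not asserted here): the `k`-fold composite `siteAvgIter k = Q' ∘ ⋯ ∘ Q'` of the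
site average (1.13) equals `L^{-kd}` times the sum over the block of order `k` (standing range). [cite: Balaban1984PropagatorsI, (1.20) p.20] -/
theorem siteAvgIter_eq_blockSum : ∀ (k : ℕ), k ≤ P.m + P.K → ∀ (lam : SiteField P 0 V) (y : Site P k),
    siteAvgIter k lam y = ((((P.L : ℝ) ^ P.d) ^ k)⁻¹) • ∑ x ∈ iterBlock k y, lam x
  | 0, _, lam, y => by simp [siteAvgIter, iterBlock_zero]
  | k + 1, hk, lam, y => by
    have hk' : k ≤ P.m + P.K := by omega
    calc siteAvgIter (k + 1) lam y
        = siteAvg (siteAvgIter k lam) y := rfl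
      _ = (((P.L : ℝ) ^ P.d)⁻¹) • ∑ z ∈ block y, siteAvgIter k lam z := siteAvg_eq_blockSum hk _ y
      _ = (((P.L : ℝ) ^ P.d)⁻¹) • ∑ z ∈ block y, ((((P.L : ℝ) ^ P.d) ^ k)⁻¹) • ∑ x ∈ iterBlock k z, lam x := by
          simp only [siteAvgIter_eq_blockSum k hk']
      _ = ((((P.L : ℝ) ^ P.d) ^ (k + 1))⁻¹) • ∑ z ∈ block y, ∑ x ∈ iterBlock k z, lam x := by
          rw [← Finset.smul_sum, smul_smul, pow_succ, mul_inv_rev]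
      _ = ((((P.L : ℝ) ^ P.d) ^ (k + 1))⁻¹) • ∑ x ∈ iterBlock (k + 1) y, lam x := by
          rw [sum_iterBlock_succ]

/-- **(1.20)** AS PRINTED, with the weight `η^d` inside the sum: `(Q'_kλ)(y) = Σ_{x∈B^k(y)} η^d λ(x)` (standing range). [cite: Balaban1984PropagatorsI, (1.20) p.20] -/
theorem eq120 {k : ℕ} (hk : k ≤ P.m + P.K) (lam : SiteField P 0 V) (y : Site P k) :
    siteAvgIter k lam y = ∑ x ∈ iterBlock k y, (P.eta k) ^ P.d • lam x := by
  rw [siteAvgIter_eq_blockSum k hk lam y, Finset.smul_sum, inv_pow_pow_eq_eta_pow]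

end OneStroke

end B5Eq118OneStroke

end Literature.MathematicalPhysics.QuantumFieldTheory.Balaban1983to89
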